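import Summits.CriticalPhenomena.SAWScalingLimit.Theorems.SAWReversalUpgradeAttachReversalDefs
import Summits.CriticalPhenomena.SAWScalingLimit.Theorems.SAWReversalUpgradeFaithfulOfNoReturnHalfPlane
import Summits.CriticalPhenomena.SAWScalingLimit.Theorems.SAWReversalUpgradeAttachmentExistsSqueeze
import Summits.CriticalPhenomena.SAWScalingLimit.Theorems.SAWReversalUpgradeAttachmentExistsInverse

/-!
# Attachment reversal, preliminaries C: the pushed polyline `Z`

Helper file for item `AttachReversal` of route `SAWReversalUpgrade` (stmt-CriticalPhenomena-18007).
For a chordal uniformizer `φ` of `(D; a, b)` with boundary extension `Φ`, squeeze angle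
`0 < e ≤ 1/2` and a continuous extended polyline `U : ℝ → ℂ` with values in `closure D`, the pushed
polyline `Z u = if U u = b then b else Φ (A_e (ψ (U u)))` (`attZ`) satisfies:

* `attZ_eq_pt_one_iff`, `attZ_eq_pt_zero_iff` — `Z u = b ↔ U u = b`, `Z u = a ↔ U u = a`;
* `continuousOn_attZ` — `Z` is continuous (the push map `Φ ∘ A_e ∘ ψ` is continuous on
  `closure D ∖ {b}` and tends to `b` at `b`, Carathéodory);
* `isCompact_midSet` and the membership criteria `pt_one_mem_midSet_iff`,
  `pt_zero_mem_midSet_iff` for the pushed middle arc `M = Z '' [i, j]`.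

Uses the tree's `FaithfulAttach.*` (boundary correspondence), `sqz_*` (squeeze) and
`inv_tendsto_cocompact`.
-/

noncomputable section

open Set Function Filter Topology Complex
open UpperHalfPlane (upperHalfPlaneSet)
open Literature.Probability.RandomPlanarGeometry

namespace Summit.CriticalPhenomena.SAWScalingLimit.Theorems.AttachReversal

/-- `squeeze e` satisfies the defining formula of the abstract squeeze (definitional). -/
theorem squeeze_spec' (e : ℝ) : ∀ z : ℂ, squeeze e z = (‖z‖ : ℂ) * Complex.exp (Complex.I * ((e : ℂ) +
    (1 - 2 * (e : ℂ) / (Real.pi : ℂ)) * (Complex.arg z : ℂ))) := fun _ => rfl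

section Generic

variable {b : ℂ} {Φ : ℂ → ℂ} {e : ℝ} {U : ℝ → ℂ} {u : ℝ}

/-- `Z u = b` where the polyline visits `b`. -/
theorem attZ_of_eq (h : U u = b) : attZ b Φ e U u = b := by
  unfold attZ; exact if_pos h

/-- `Z u = Φ (A_e (ψ (U u)))` where the polyline is off `b`. -/
theorem attZ_of_ne (h : U u ≠ b) : attZ b Φ e U u = Φ (squeeze e (hinv Φ (U u))) := by
  unfold attZ; exact if_neg h

end Generic

variable {D : DobrushinDomain} {φ : ConformalEquiv upperHalfPlaneSet D.carrier} {e : ℝ} {U : ℝ → ℂ}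

/-- `ψ w ∈ ℍ̄` for `w ∈ closure D ∖ {b}` (as a `hinv` statement). -/
theorem hinv_im_nonneg (hφ : D.IsChordalUniformizing φ) {w : ℂ} (hw : w ∈ closure D.carrier)
    (hwb : w ≠ D.pt 1) : 0 ≤ (hinv φ.boundaryExtension w).im :=
  (FaithfulAttach.invFun_spec hφ hw hwb).1

/-- `Φ (ψ w) = w` for `w ∈ closure D ∖ {b}`. -/
theorem bExt_hinv (hφ : D.IsChordalUniformizing φ) {w : ℂ} (hw : w ∈ closure D.carrier)
    (hwb : w ≠ D.pt 1) : φ.boundaryExtension (hinv φ.boundaryExtension w) = w :=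
  (FaithfulAttach.invFun_spec hφ hw hwb).2

/-- **`Z u = b ↔ U u = b`** (for `U u ∈ closure D`): off `b`, `Z u` is a value of `Φ` on `ℍ̄`. -/
theorem attZ_eq_pt_one_iff (hφ : D.IsChordalUniformizing φ) (he : 0 < e) (he' : e ≤ 1 / 2) {u : ℝ}
    (hu : U u ∈ closure D.carrier) :
    attZ (D.pt 1) φ.boundaryExtension e U u = D.pt 1 ↔ U u = D.pt 1 := by
  refine ⟨fun h => ?_, attZ_of_eq⟩
  by_contra hne
  rw [attZ_of_ne hne] at h
  exact FaithfulAttach.bext_ne_pt_one hφ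
    (sqz_im_nonneg he he' (squeeze_spec' e) (hinv_im_nonneg hφ hu hne)) h

/-- **`Z u = a ↔ U u = a`** (for `U u ∈ closure D`). -/
theorem attZ_eq_pt_zero_iff (hφ : D.IsChordalUniformizing φ) (he : 0 < e) (he' : e ≤ 1 / 2) {u : ℝ}
    (hu : U u ∈ closure D.carrier) :
    attZ (D.pt 1) φ.boundaryExtension e U u = D.pt 0 ↔ U u = D.pt 0 := by
  have hab : D.pt 0 ≠ D.pt 1 := D.pt_injective.ne (by decide)
  by_cases hb : U u = D.pt 1
  · rw [attZ_of_eq hb, hb]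
  rw [attZ_of_ne hb]
  have him := hinv_im_nonneg hφ hu hb
  rw [FaithfulAttach.bext_eq_pt_zero_iff hφ (sqz_im_nonneg he he' (squeeze_spec' e) him),
    sqz_eq_zero_iff (squeeze_spec' e), hinv]
  exact FaithfulAttach.invFun_eq_zero_iff hφ hu hb

/-- `Z u ∈ closure D` (for `U u ∈ closure D`). -/
theorem attZ_mem_closure (hφ : D.IsChordalUniformizing φ) (he : 0 < e) (he' : e ≤ 1 / 2) {u : ℝ}
    (hu : U u ∈ closure D.carrier) :
    attZ (D.pt 1) φ.boundaryExtension e U u ∈ closure D.carrier := by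
  by_cases hb : U u = D.pt 1
  · rw [attZ_of_eq hb]; exact FaithfulAttach.pt_mem_closure D 1
  · rw [attZ_of_ne hb]
    exact FaithfulAttach.bext_mem_closure φ (sqz_im_nonneg he he' (squeeze_spec' e) (hinv_im_nonneg hφ hu hb))

/-- Off `a` and `b`, `Z u ∈ D` (the squeeze pushes `ℍ̄ ∖ {0}` into `ℍ`). -/
theorem attZ_mem_carrier (hφ : D.IsChordalUniformizing φ) (he : 0 < e) (he' : e ≤ 1 / 2) {u : ℝ}
    (hu : U u ∈ closure D.carrier) (hua : U u ≠ D.pt 0) (hub : U u ≠ D.pt 1) :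
    attZ (D.pt 1) φ.boundaryExtension e U u ∈ D.carrier := by
  rw [attZ_of_ne hub]
  refine FaithfulAttach.bext_mem_carrier φ (sqz_im_pos he he' (squeeze_spec' e) (hinv_im_nonneg hφ hu hub) ?_)
  rw [hinv, Ne, FaithfulAttach.invFun_eq_zero_iff hφ hu hub]
  exact hua

/-! ### Continuity -/

/-- The push map `w ↦ Φ (A_e (ψ w))` is continuous on `closure D ∖ {b}`. -/
theorem continuousOn_push (hφ : D.IsChordalUniformizing φ) (he : 0 < e) (he' : e ≤ 1 / 2) :
    ContinuousOn (fun w => φ.boundaryExtension (squeeze e (hinv φ.boundaryExtension w)))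
      (closure D.carrier \ {D.pt 1}) := by
  refine (continuousOn_boundaryExtension_im_nonneg φ).comp
    ((sqz_continuousOn (squeeze_spec' e)).comp (FaithfulAttach.continuousOn_invFun hφ) ?_) ?_
  · exact fun w hw => (FaithfulAttach.invFun_spec hφ hw.1 hw.2).1
  · exact fun w hw => sqz_im_nonneg he he' (squeeze_spec' e) (FaithfulAttach.invFun_spec hφ hw.1 hw.2).1

/-- **The push map tends to `b` at `b`** within `closure D ∖ {b}`: `ψ w → ∞`, `|A_e| = |·|`,
`Φ(∞) = b`. -/
theorem tendsto_push_pt_one (hφ : D.IsChordalUniformizing φ) (he : 0 < e) (he' : e ≤ 1 / 2) :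
    Tendsto (fun w => φ.boundaryExtension (squeeze e (hinv φ.boundaryExtension w)))
      (𝓝[closure D.carrier \ {D.pt 1}] (D.pt 1)) (𝓝 (D.pt 1)) := by
  have hψ : Tendsto (hinv φ.boundaryExtension) (𝓝[closure D.carrier \ {D.pt 1}] (D.pt 1))
      (cocompact ℂ ⊓ 𝓟 {z : ℂ | 0 ≤ z.im}) := by
    refine tendsto_inf.2 ⟨?_, tendsto_principal.2 ?_⟩
    · exact inv_tendsto_cocompact (D := D.carrier) (continuousOn_boundaryExtension_im_nonneg φ)
        (fun z hz => FaithfulAttach.bext_ne_pt_one hφ hz)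
        (fun p hp => FaithfulAttach.bext_surjOn hφ hp)
    · filter_upwards [self_mem_nhdsWithin] with w hw
      exact (FaithfulAttach.invFun_spec hφ hw.1 hw.2).1
  exact hφ.tendsto_boundaryExtension_cocompact.comp
    ((sqz_tendsto_cocompact he he' (squeeze_spec' e)).comp hψ)

/-- **The pushed polyline is continuous** on every set of times mapped into `closure D`. -/
theorem continuousOn_attZ (hφ : D.IsChordalUniformizing φ) (he : 0 < e) (he' : e ≤ 1 / 2)
    (hU : Continuous U) {S : Set ℝ} (hS : ∀ t ∈ S, U t ∈ closure D.carrier) :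
    ContinuousOn (attZ (D.pt 1) φ.boundaryExtension e U) S := by
  intro t ht
  set F : ℂ → ℂ := fun w => φ.boundaryExtension (squeeze e (hinv φ.boundaryExtension w)) with hF
  by_cases hb : U t = D.pt 1
  · -- at a visit of `b`: `Z = b` there and `F (U ·) → b` elsewhere
    show Tendsto (attZ (D.pt 1) φ.boundaryExtension e U) (𝓝[S] t) (𝓝 (attZ (D.pt 1) φ.boundaryExtension e U t))
    rw [attZ_of_eq hb]
    have hU' : Tendsto U (𝓝[S] t ⊓ 𝓟 {x | ¬ U x = D.pt 1})
        (𝓝[closure D.carrier \ {D.pt 1}] (D.pt 1)) := by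
      refine tendsto_nhdsWithin_iff.2 ⟨?_, ?_⟩
      · rw [← hb]
        exact ((hU.tendsto t).mono_left nhdsWithin_le_nhds).mono_left inf_le_left
      · have h1 : ∀ᶠ x in 𝓝[S] t ⊓ 𝓟 {x | ¬ U x = D.pt 1}, x ∈ S :=
          mem_inf_of_left self_mem_nhdsWithin
        have h2 : ∀ᶠ x in 𝓝[S] t ⊓ 𝓟 {x | ¬ U x = D.pt 1}, ¬ U x = D.pt 1 :=
          mem_inf_of_right (mem_principal_self _)
        filter_upwards [h1, h2] with x hx1 hx2
        exact ⟨hS x hx1, hx2⟩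
    have key := (tendsto_push_pt_one hφ he he').comp hU'
    exact @Filter.Tendsto.if _ _ _ _ _ _ _ (fun x => Classical.propDecidable _) tendsto_const_nhds key
  · -- off `b`: `Z = F ∘ U` near `t`
    have hev : ∀ᶠ x in 𝓝[S] t, attZ (D.pt 1) φ.boundaryExtension e U x = F (U x) := by
      have : ∀ᶠ x in 𝓝 t, U x ≠ D.pt 1 :=
        (hU.tendsto t).eventually (isOpen_ne.eventually_mem hb)
      filter_upwards [mem_nhdsWithin_of_mem_nhds this] with x hx
      exact attZ_of_ne hx
    have hUt : Tendsto U (𝓝[S] t) (𝓝[closure D.carrier \ {D.pt 1}] (U t)) := by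
      refine tendsto_nhdsWithin_iff.2 ⟨(hU.tendsto t).mono_left nhdsWithin_le_nhds, ?_⟩
      have : ∀ᶠ x in 𝓝 t, U x ≠ D.pt 1 :=
        (hU.tendsto t).eventually (isOpen_ne.eventually_mem hb)
      filter_upwards [self_mem_nhdsWithin, mem_nhdsWithin_of_mem_nhds this] with x hx hx'
      exact ⟨hS x hx, hx'⟩
    have hc : Tendsto (fun x => F (U x)) (𝓝[S] t) (𝓝 (F (U t))) :=
      ((continuousOn_push hφ he he') (U t) ⟨hS t ht, hb⟩).tendsto.comp hUt
    show Tendsto (attZ (D.pt 1) φ.boundaryExtension e U) (𝓝[S] t) (𝓝 (attZ (D.pt 1) φ.boundaryExtension e U t))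
    rw [attZ_of_ne hb]
    exact hc.congr' (hev.mono fun x hx => hx.symm)

/-! ### The pushed middle arc -/

/-- `lastA ∈ [0, 1]` and `firstB ∈ [0, 1]`, so the trimmed interval lies in `[0, 1]`. -/
theorem Icc_lastA_firstB_subset (a b : ℂ) (U : ℝ → ℂ) :
    Icc (lastA a U) (firstB b U) ⊆ Icc (0:ℝ) 1 := by
  have hi : 0 ≤ lastA a U :=
    le_csSup ⟨1, by rintro u (rfl | ⟨hu, -⟩) <;> [exact zero_le_one; exact hu.2]⟩ (Or.inl rfl)
  have hj : firstB b U ≤ 1 :=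
    csInf_le ⟨0, by rintro u (rfl | ⟨hu, -⟩) <;> [exact zero_le_one; exact hu.1]⟩ (Or.inl rfl)
  exact Icc_subset_Icc hi hj

/-- **The pushed middle arc is compact.** -/
theorem isCompact_midSet (hφ : D.IsChordalUniformizing φ) (he : 0 < e) (he' : e ≤ 1 / 2)
    (hU : Continuous U) (hrange : ∀ t, U t ∈ closure D.carrier) :
    IsCompact (midSet (D.pt 0) (D.pt 1) φ.boundaryExtension e U) :=
  isCompact_Icc.image_of_continuousOn (continuousOn_attZ hφ he he' hU fun t _ => hrange t)

/-- The pushed middle arc lies in `closure D`. -/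
theorem midSet_subset_closure (hφ : D.IsChordalUniformizing φ) (he : 0 < e) (he' : e ≤ 1 / 2)
    (hrange : ∀ t, U t ∈ closure D.carrier) :
    midSet (D.pt 0) (D.pt 1) φ.boundaryExtension e U ⊆ closure D.carrier := by
  rintro _ ⟨t, -, rfl⟩
  exact attZ_mem_closure hφ he he' (hrange t)

/-- A visit of `b` inside the trimmed interval happens at its right end `j = firstB`. -/
theorem eq_firstB_of_mem_Icc {a b : ℂ} {t : ℝ} (ht : t ∈ Icc (lastA a U) (firstB b U)) (hUt : U t = b) :
    t = firstB b U := by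
  have ht01 : t ∈ Icc (0:ℝ) 1 := Icc_lastA_firstB_subset a b U ht
  have h1 : firstB b U ≤ t :=
    csInf_le ⟨0, by rintro u (rfl | ⟨hu, -⟩) <;> [exact zero_le_one; exact hu.1]⟩ (Or.inr ⟨ht01, hUt⟩)
  exact le_antisymm ht.2 h1

/-- A visit of `a` inside the trimmed interval happens at its left end `i = lastA`. -/
theorem eq_lastA_of_mem_Icc {a b : ℂ} {t : ℝ} (ht : t ∈ Icc (lastA a U) (firstB b U)) (hUt : U t = a) :
    t = lastA a U := by
  have ht01 : t ∈ Icc (0:ℝ) 1 := Icc_lastA_firstB_subset a b U ht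
  have h1 : t ≤ lastA a U :=
    le_csSup ⟨1, by rintro u (rfl | ⟨hu, -⟩) <;> [exact zero_le_one; exact hu.2]⟩ (Or.inr ⟨ht01, hUt⟩)
  exact le_antisymm h1 ht.1

/-- **`b ∈ M ↔` the trimmed interval is nonempty and ends at a visit of `b`.** -/
theorem pt_one_mem_midSet_iff (hφ : D.IsChordalUniformizing φ) (he : 0 < e) (he' : e ≤ 1 / 2)
    (hrange : ∀ t, U t ∈ closure D.carrier) :
    D.pt 1 ∈ midSet (D.pt 0) (D.pt 1) φ.boundaryExtension e U ↔
      lastA (D.pt 0) U ≤ firstB (D.pt 1) U ∧ U (firstB (D.pt 1) U) = D.pt 1 := by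
  constructor
  · rintro ⟨t, ht, hZ⟩
    rw [attZ_eq_pt_one_iff hφ he he' (hrange t)] at hZ
    have := eq_firstB_of_mem_Icc ht hZ
    subst this
    exact ⟨ht.1.trans ht.2, hZ⟩
  · rintro ⟨hle, hj⟩
    exact ⟨firstB (D.pt 1) U, ⟨hle, le_rfl⟩, attZ_of_eq hj⟩

/-- **`a ∈ M ↔` the trimmed interval is nonempty and starts at a visit of `a`.** -/
theorem pt_zero_mem_midSet_iff (hφ : D.IsChordalUniformizing φ) (he : 0 < e) (he' : e ≤ 1 / 2)
    (hrange : ∀ t, U t ∈ closure D.carrier) :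
    D.pt 0 ∈ midSet (D.pt 0) (D.pt 1) φ.boundaryExtension e U ↔
      lastA (D.pt 0) U ≤ firstB (D.pt 1) U ∧ U (lastA (D.pt 0) U) = D.pt 0 := by
  constructor
  · rintro ⟨t, ht, hZ⟩
    rw [attZ_eq_pt_zero_iff hφ he he' (hrange t)] at hZ
    have := eq_lastA_of_mem_Icc ht hZ
    subst this
    exact ⟨ht.1.trans ht.2, hZ⟩
  · rintro ⟨hle, hi⟩
    refine ⟨lastA (D.pt 0) U, ⟨le_rfl, hle⟩, ?_⟩
    rw [attZ_eq_pt_zero_iff hφ he he' (hrange _)]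
    exact hi

end Summit.CriticalPhenomena.SAWScalingLimit.Theorems.AttachReversal

end
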